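import Summits.BirchSwinnertonDyer.BirchSwinnertonDyer.Theorems.UniversalToricDescentHessianTwinSemistableAtThree
import HarnessLib

/-!
# Route `UniversalToricDescent`, crux #3 bucket B (item 20694 `TwinSplitIMCAtThreeMult`): the Hessian is a MULTIPLICATIVE twin on the `3`-adic types `(≥3, 4, 5)` and `(≥6, 8, ·)` — the general rescaling identity (PROVED, unconditional)

Cell `bsd-wall` (W-ALL lane 3, row 2·3@3), seat `bsd-wall-utd-p2` g7 (LEAD, line mode; second item 20694),
2026-08-27. `--supports stmt-BirchSwinnertonDyer-20694`. Third Hessian file (after `…HessianTwinAtThree`: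
`(4, ≥7)` ↦ good supersingular `a₃ = 0`; `…HessianTwinSemistableAtThree`: `v₃(c₆) = 6` ↦ multiplicative /
good ordinary).

WHAT IS PROVED (no `sorry`, no named fact).
* §1 the integer model `P(S, w) = [0, −4w, 0, 4w² + S, −2Sw]` (`S, w ∈ ℤ`): `c₄ = 16(4w² − 3S)` (a `3`-adic
  unit iff `3 ∤ w`), `Δ = 64S²(w² − S)` (divisible by `3` if `3 ∣ S`).
* §2 `rescaleShift_hessePencil3_zero_one_general` — THE GENERAL IDENTITY: for every `μ ≠ 0`, writing
  `c₆ = μ²w` and `c₄³ = μ⁴S`, `⟨3μ, −12μ²w, 0, 0⟩ • D(0:1) = P(S, w) ⊗ ℚ` where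
  `D(0:1) = Fisher2012.hessePencil3 c₄ c₆ 0 1 : y² = x³ − 27(4c₆² − 3c₄³)x − 54(9c₄³c₆ − 8c₆³)` is the Hessian
  member (`μ = 27`: the `v₃(c₆) = 6` file; `μ = 9`: types `(≥3, 4, ·)`; `μ = 81`: types `(≥6, 8, ·)`).
* §3 `hasMultiplicativeReductionAtPrime_smul_hessePencil3_zero_one_of_S`: `3 ∤ w`, `3 ∣ S` ⟹ EVERY model
  `C • D(0:1)` is multiplicative at `3`; `exists_mult_twin_of_S` (named, globally minimal, `3`-congruent twin).
* §4 valuation currency: `exists_mult_twin_of_padicValRat_three_four` (`3 ≤ v₃(c₄)`, `v₃(c₆) = 4`: the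
  types `(k, 4, 5)`, `k ≥ 3`) and `exists_mult_twin_of_padicValRat_six_eight` (`6 ≤ v₃(c₄)`, `v₃(c₆) = 8`: the
  types `(6, 8, 13)` and `(k, 8, 13)`, `k ≥ 7`), each with the twin-cell form (onto image inherited).

READING. With the two companion files, EVERY row of utd-idea g9's HESSIAN LAW table (LENS-MEMO v11 §6) that
maps to a semistable Hessian is now a theorem for every curve of the type: `(4,7,9)` ↦ good supersingular
`a₃ = 0` (bucket C, `603/603`); `(4,6,9)` ↦ good ordinary; `(4,6,≥10)`, `(≥5,6,9)`, `(≥3,4,5)`, `(≥6,8,·)` ↦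
multiplicative (bucket B, `673/673`). On all these types a wild curve with onto mod-`3` image is ON THE TWIN
CELL of `WAllExclAddWildRankOneSurjTwin` with a CANONICAL twin. Bucket B's crux is neither proved nor reduced.

HONEST FRAMING: helper theorems; nothing closes; no statement item filed (D-0014); no new definition; BSD is
not proved for any curve. References: T. Fisher, Proc. LMS (3) 104 (2012) §8, Thm. 13.2 [Fisher2012Hessian];
J. H. Silverman, *AEC* VII.5 Prop. 5.1 [SilvermanAEC2009].
-/

set_option autoImplicit false
set_option linter.dupNamespace false

noncomputable section

namespace Summit.BirchSwinnertonDyer.BirchSwinnertonDyer.Theorems.UniversalToricDescentHessianTwin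

open WeierstrassCurve
  Literature.NumberTheory.EllipticCurves
  Literature.NumberTheory.EllipticCurves.Rank1Residual
  Literature.NumberTheory.EllipticCurves.Fisher2012
  Literature.NumberTheory.EllipticCurves.BSZLemma17
  Literature.NumberTheory.EllipticCurves.BurungaleSkinner2023
  Summit.BirchSwinnertonDyer.Rank1Residual
  Summit.BirchSwinnertonDyer.BirchSwinnertonDyer.Theorems.UniversalToricDescentTwinChoice

/-! ## §1 The integer model `P(S, w) = [0, −4w, 0, 4w² + S, −2Sw]` -/

/-- `c₄(P(S,w)) = 16(4w² − 3S)`. [folklore] -/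
theorem c₄_hessianIntModelS (S w : ℤ) :
    (⟨0, -4 * w, 0, 4 * w ^ 2 + S, -2 * S * w⟩ : WeierstrassCurve ℤ).c₄ = 16 * (4 * w ^ 2 - 3 * S) := by
  simp only [WeierstrassCurve.c₄, WeierstrassCurve.b₂, WeierstrassCurve.b₄]
  ring

/-- `Δ(P(S,w)) = 64S²(w² − S)`. [folklore] -/
theorem Δ_hessianIntModelS (S w : ℤ) :
    (⟨0, -4 * w, 0, 4 * w ^ 2 + S, -2 * S * w⟩ : WeierstrassCurve ℤ).Δ = 64 * (S ^ 2 * (w ^ 2 - S)) := by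
  simp only [WeierstrassCurve.Δ, WeierstrassCurve.b₂, WeierstrassCurve.b₄, WeierstrassCurve.b₆,
    WeierstrassCurve.b₈]
  ring

/-- `3 ∤ c₄(P(S,w))` when `3 ∤ w`. [folklore] -/
theorem three_not_dvd_c₄_hessianIntModelS (S w : ℤ) (hw : ¬ (3 : ℤ) ∣ w) :
    ¬ (3 : ℤ) ∣ (⟨0, -4 * w, 0, 4 * w ^ 2 + S, -2 * S * w⟩ : WeierstrassCurve ℤ).c₄ := by
  rw [c₄_hessianIntModelS]
  intro h
  apply hw
  have h3 : (((16 * (4 * w ^ 2 - 3 * S) : ℤ)) : ZMod 3) = 0 := by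
    rw [ZMod.intCast_zmod_eq_zero_iff_dvd]; exact_mod_cast h
  have hw3 : (w : ZMod 3) = 0 := by
    push_cast at h3
    generalize (S : ZMod 3) = a at h3
    generalize (w : ZMod 3) = b at h3 ⊢
    revert a b
    decide
  rw [ZMod.intCast_zmod_eq_zero_iff_dvd] at hw3
  exact_mod_cast hw3

/-- `3 ∣ Δ(P(S,w))` when `3 ∣ S`. [folklore] -/
theorem three_dvd_Δ_hessianIntModelS (S w : ℤ) (hS : (3 : ℤ) ∣ S) :
    (3 : ℤ) ∣ (⟨0, -4 * w, 0, 4 * w ^ 2 + S, -2 * S * w⟩ : WeierstrassCurve ℤ).Δ := by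
  rw [Δ_hessianIntModelS]
  exact dvd_mul_of_dvd_right (dvd_mul_of_dvd_left (dvd_pow hS two_ne_zero) _) 64

/-! ## §2 The general rescaling identity -/

/-- **THE GENERAL IDENTITY.** For `μ ≠ 0`, `c₆ = μ²w`, `c₄³ = μ⁴S`:
`⟨3μ, −12μ²w, 0, 0⟩ • D(0:1) = [0, −4w, 0, 4w² + S, −2Sw]` (over `ℚ`), where `D(0:1)` is the Hesse member
`y² = x³ − 27(4c₆² − 3c₄³)x − 54(9c₄³c₆ − 8c₆³)` of `W`. [cite: Fisher2012Hessian, §8 (Hesse polynomials, n = 3)] -/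
theorem rescaleShift_hessePencil3_zero_one_general (W : WeierstrassCurve ℚ) (μ w S : ℚ) (hμ : μ ≠ 0)
    (h6 : W.c₆ = μ ^ 2 * w) (h4 : W.c₄ ^ 3 = μ ^ 4 * S) :
    (⟨Units.mk0 (3 * μ) (mul_ne_zero (by norm_num) hμ), -12 * μ ^ 2 * w, 0, 0⟩ : VariableChange ℚ) •
        hessePencil3 W.c₄ W.c₆ 0 1 = ⟨0, -4 * w, 0, 4 * w ^ 2 + S, -2 * S * w⟩ := by
  rw [hessePencil3_eq, h6]
  have h4' : W.c₄ ^ 3 = μ ^ 4 * S := h4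
  ext
  · simp [variableChange_a₁]
  · simp only [variableChange_a₂, Units.val_inv_eq_inv_val, Units.val_mk0]
    field_simp
    ring
  · simp [variableChange_a₃]
  · simp only [variableChange_a₄, Units.val_inv_eq_inv_val, Units.val_mk0]
    field_simp
    linear_combination (81 : ℚ) * h4'
  · simp only [variableChange_a₆, Units.val_inv_eq_inv_val, Units.val_mk0]
    field_simp
    linear_combination (-1458 * μ ^ 2 * w) * h4'

/-- The general identity with INTEGER parameters, as a base change of `P(S, w)`. [folklore] -/
theorem rescaleShift_hessePencil3_zero_one_int (W : WeierstrassCurve ℚ) (μ : ℚ) (w S : ℤ) (hμ : μ ≠ 0)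
    (h6 : W.c₆ = μ ^ 2 * w) (h4 : W.c₄ ^ 3 = μ ^ 4 * S) :
    (⟨Units.mk0 (3 * μ) (mul_ne_zero (by norm_num) hμ), -12 * μ ^ 2 * w, 0, 0⟩ : VariableChange ℚ) •
        hessePencil3 W.c₄ W.c₆ 0 1 =
      (⟨0, -4 * w, 0, 4 * w ^ 2 + S, -2 * S * w⟩ : WeierstrassCurve ℤ).baseChange ℚ := by
  rw [rescaleShift_hessePencil3_zero_one_general W μ w S hμ h6 h4]
  ext <;> simp [WeierstrassCurve.baseChange, WeierstrassCurve.map]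

/-! ## §3 Multiplicative Hessian from `3 ∤ w`, `3 ∣ S` -/

/-- **MULTIPLICATIVE HESSIAN (general).** `μ ≠ 0`, `c₆ = μ²w`, `c₄³ = μ⁴S` with `w, S ∈ ℤ`, `3 ∤ w`,
`3 ∣ S` ⟹ every model `C • D(0:1)` is multiplicative at `3`. [folklore] -/
theorem hasMultiplicativeReductionAtPrime_smul_hessePencil3_zero_one_of_S (W : WeierstrassCurve ℚ)
    (μ : ℚ) (w S : ℤ) (hμ : μ ≠ 0) (hw : ¬ (3 : ℤ) ∣ w) (hS : (3 : ℤ) ∣ S) (h6 : W.c₆ = μ ^ 2 * w)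
    (h4 : W.c₄ ^ 3 = μ ^ 4 * S) (C : VariableChange ℚ) [(C • hessePencil3 W.c₄ W.c₆ 0 1).IsElliptic] :
    (C • hessePencil3 W.c₄ W.c₆ 0 1).HasMultiplicativeReductionAtPrime 3 := by
  set M := C • hessePencil3 W.c₄ W.c₆ 0 1 with hM
  set C₁ : VariableChange ℚ :=
    ⟨Units.mk0 (3 * μ) (mul_ne_zero (by norm_num) hμ), -12 * μ ^ 2 * w, 0, 0⟩ with hC₁
  have hkey : (C₁ * C⁻¹) • M =
      (⟨0, -4 * w, 0, 4 * w ^ 2 + S, -2 * S * w⟩ : WeierstrassCurve ℤ).baseChange ℚ := by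
    rw [hM, mul_smul, inv_smul_smul]
    exact rescaleShift_hessePencil3_zero_one_int W μ w S hμ h6 h4
  haveI : ((⟨0, -4 * w, 0, 4 * w ^ 2 + S, -2 * S * w⟩ : WeierstrassCurve ℤ).baseChange ℚ).IsElliptic := by
    rw [← hkey]; infer_instance
  rw [← BSZLemma17.hasMultiplicativeReductionAtPrime_smul_iff M (C₁ * C⁻¹) 3, hkey]
  exact hasMultiplicativeReductionAtPrime_baseChange_int_of_dvd_of_not_dvd _
    (three_dvd_Δ_hessianIntModelS S w hS) (three_not_dvd_c₄_hessianIntModelS S w hw)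

/-- **MULTIPLICATIVE TWIN, NAMED (general integer form).** Under the same hypotheses and `c₄ ≠ 0`, `W` has a
globally minimal `3`-congruent twin multiplicative at `3` — a global minimal model of its Hessian member
`D(0:1)` (Fisher Thm. 13.2, tree-proved; Néron's global minimal model, tree-proved). [folklore] -/
theorem exists_mult_twin_of_S (W : WeierstrassCurve ℚ) [W.IsElliptic] (μ : ℚ) (w S : ℤ) (hμ : μ ≠ 0)
    (hw : ¬ (3 : ℤ) ∣ w) (hS : (3 : ℤ) ∣ S) (h6 : W.c₆ = μ ^ 2 * w) (h4 : W.c₄ ^ 3 = μ ^ 4 * S)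
    (hc4 : W.c₄ ≠ 0) :
    ∃ (W' : WeierstrassCurve ℚ) (_ : W'.IsElliptic) (_ : W'.IsGloballyMinimal),
      O6.ModPCongruent W' W 3 ∧ Mult W' 3 := by
  haveI := isElliptic_hessePencil3_zero_one W hc4
  obtain ⟨C, hC⟩ := WeierstrassCurve.hasGlobalMinimalModel_rat_holds (hessePencil3 W.c₄ W.c₆ 0 1)
  haveI := hC
  exact ⟨C • hessePencil3 W.c₄ W.c₆ 0 1, inferInstance, hC, modPCongruent_smul_hessePencil3_zero_one W hc4 C,
    hasMultiplicativeReductionAtPrime_smul_hessePencil3_zero_one_of_S W μ w S hμ hw hS h6 h4 C⟩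

/-! ## §4 Valuation currency: types `(≥3, 4, ·)` and `(≥6, 8, ·)` -/

/-- `v₃(n) = k ≠ 0` for an integer `n` (read in `ℚ`) means `n = 3ᵏw` with `3 ∤ w`. [folklore] -/
theorem exists_eq_pow_mul_not_dvd_of_padicValRat_eq (n : ℤ) (k : ℕ) (hk : k ≠ 0)
    (h : padicValRat 3 (n : ℚ) = k) : ∃ w : ℤ, ¬ (3 : ℤ) ∣ w ∧ n = 3 ^ k * w := by
  rw [padicValRat.of_int] at h
  have h' : padicValInt 3 n = k := by exact_mod_cast h
  have hn : n ≠ 0 := by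
    rintro rfl
    rw [padicValInt.zero] at h'
    exact hk h'.symm
  obtain ⟨w, hw⟩ : (3 : ℤ) ^ k ∣ n := (padicValInt_dvd_iff k n).mpr (Or.inr h'.ge)
  refine ⟨w, fun h3 ↦ ?_, hw⟩
  have hk' : (3 : ℤ) ^ (k + 1) ∣ n := by
    rw [hw, pow_succ]
    exact mul_dvd_mul_left _ h3
  rcases (padicValInt_dvd_iff (k + 1) n).mp hk' with h0 | hk''
  · exact hn h0
  · rw [h'] at hk''
    omega

/-- `k ≤ v₃(n)` for an integer `n` (read in `ℚ`), `k ≥ 1`, gives `n = 3ᵏx` with `n ≠ 0`. [folklore] -/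
theorem exists_eq_pow_mul_of_le_padicValRat (n : ℤ) (k : ℕ) (hk : 1 ≤ k)
    (h : (k : ℤ) ≤ padicValRat 3 (n : ℚ)) : ∃ x : ℤ, n ≠ 0 ∧ n = 3 ^ k * x := by
  rw [padicValRat.of_int] at h
  have h' : k ≤ padicValInt 3 n := by exact_mod_cast h
  have hn : n ≠ 0 := by
    rintro rfl
    rw [padicValInt.zero] at h'
    omega
  obtain ⟨x, hx⟩ : (3 : ℤ) ^ k ∣ n := (padicValInt_dvd_iff k n).mpr (Or.inr h')
  exact ⟨x, hn, hx⟩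

/-- **MULTIPLICATIVE TWIN on the types `(≥3, 4, ·)`** (bucket-B rows `(k, 4, 5)`, `k ≥ 3`): every globally
minimal elliptic `W/ℚ` with `3 ≤ v₃(c₄)`, `v₃(c₆) = 4` has a globally minimal `3`-congruent twin multiplicative
at `3` (its Hessian; `μ = 9`, `S = 3x³` for `c₄ = 27x`). [folklore] -/
theorem exists_mult_twin_of_padicValRat_three_four (W : WeierstrassCurve ℚ) [W.IsElliptic]
    [W.IsGloballyMinimal] (h3 : 3 ≤ padicValRat 3 W.c₄) (h4 : padicValRat 3 W.c₆ = 4) :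
    ∃ (W' : WeierstrassCurve ℚ) (_ : W'.IsElliptic) (_ : W'.IsGloballyMinimal),
      O6.ModPCongruent W' W 3 ∧ Mult W' 3 := by
  rw [c₄_eq_intCast_c₄_integralModelInt W] at h3
  rw [c₆_eq_intCast_c₆_integralModelInt W] at h4
  obtain ⟨x, hn0, hx⟩ := exists_eq_pow_mul_of_le_padicValRat _ 3 (by norm_num) (by exact_mod_cast h3)
  obtain ⟨w, hw, hw'⟩ := exists_eq_pow_mul_not_dvd_of_padicValRat_eq _ 4 (by norm_num) (by exact_mod_cast h4)
  have hc4 : W.c₄ = 27 * x := by rw [c₄_eq_intCast_c₄_integralModelInt W, hx]; push_cast; ring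
  have hc6 : W.c₆ = (9 : ℚ) ^ 2 * (w : ℤ) := by rw [c₆_eq_intCast_c₆_integralModelInt W, hw']; push_cast; ring
  refine exists_mult_twin_of_S W 9 w (3 * x ^ 3) (by norm_num) hw (dvd_mul_right 3 _) hc6 ?_ ?_
  · rw [hc4]; push_cast; ring
  · rw [c₄_eq_intCast_c₄_integralModelInt W]; exact_mod_cast hn0

/-- **MULTIPLICATIVE TWIN on the types `(≥6, 8, ·)`** (bucket-B row `(6, 8, 13)` and `(k, 8, 13)`, `k ≥ 7`):
every globally minimal elliptic `W/ℚ` with `6 ≤ v₃(c₄)`, `v₃(c₆) = 8` has a globally minimal `3`-congruent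
twin multiplicative at `3` (its Hessian; `μ = 81`, `S = 9x³` for `c₄ = 729x`). [folklore] -/
theorem exists_mult_twin_of_padicValRat_six_eight (W : WeierstrassCurve ℚ) [W.IsElliptic]
    [W.IsGloballyMinimal] (h6 : 6 ≤ padicValRat 3 W.c₄) (h8 : padicValRat 3 W.c₆ = 8) :
    ∃ (W' : WeierstrassCurve ℚ) (_ : W'.IsElliptic) (_ : W'.IsGloballyMinimal),
      O6.ModPCongruent W' W 3 ∧ Mult W' 3 := by
  rw [c₄_eq_intCast_c₄_integralModelInt W] at h6
  rw [c₆_eq_intCast_c₆_integralModelInt W] at h8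
  obtain ⟨x, hn0, hx⟩ := exists_eq_pow_mul_of_le_padicValRat _ 6 (by norm_num) (by exact_mod_cast h6)
  obtain ⟨w, hw, hw'⟩ := exists_eq_pow_mul_not_dvd_of_padicValRat_eq _ 8 (by norm_num) (by exact_mod_cast h8)
  have hc4 : W.c₄ = 729 * x := by rw [c₄_eq_intCast_c₄_integralModelInt W, hx]; push_cast; ring
  have hc6 : W.c₆ = (81 : ℚ) ^ 2 * (w : ℤ) := by rw [c₆_eq_intCast_c₆_integralModelInt W, hw']; push_cast; ring
  refine exists_mult_twin_of_S W 81 w (9 * x ^ 3) (by norm_num) hw ⟨3 * x ^ 3, by ring⟩ hc6 ?_ ?_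
  · rw [hc4]; push_cast; ring
  · rw [c₄_eq_intCast_c₄_integralModelInt W]; exact_mod_cast hn0

/-- **Twin cell on the types `(≥3, 4, ·)`**: with onto mod-`3` image, `W` has a globally minimal `3`-congruent
twin NOT additive at `3` with onto image — named (its Hessian). [folklore] -/
theorem exists_semistable_surj_twin_of_padicValRat_three_four (W : WeierstrassCurve ℚ) [W.IsElliptic]
    [W.IsGloballyMinimal] (h3 : 3 ≤ padicValRat 3 W.c₄) (h4 : padicValRat 3 W.c₆ = 4)
    (hs : W.HasSurjectiveModNGaloisRep 3) :
    ∃ (W' : WeierstrassCurve ℚ) (_ : W'.IsElliptic) (_ : W'.IsGloballyMinimal),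
      O6.ModPCongruent W' W 3 ∧ ¬ Addv W' 3 ∧ W'.HasSurjectiveModNGaloisRep 3 := by
  obtain ⟨W', i1, i2, hc, hm⟩ := exists_mult_twin_of_padicValRat_three_four W h3 h4
  exact ⟨W', i1, i2, hc, fun h ↦ h.2 hm, hasSurjectiveModNGaloisRep_of_modPCongruent' hc hs⟩

/-- **Twin cell on the types `(≥6, 8, ·)`**: with onto mod-`3` image, `W` has a globally minimal `3`-congruent
twin NOT additive at `3` with onto image — named (its Hessian). [folklore] -/
theorem exists_semistable_surj_twin_of_padicValRat_six_eight (W : WeierstrassCurve ℚ) [W.IsElliptic]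
    [W.IsGloballyMinimal] (h6 : 6 ≤ padicValRat 3 W.c₄) (h8 : padicValRat 3 W.c₆ = 8)
    (hs : W.HasSurjectiveModNGaloisRep 3) :
    ∃ (W' : WeierstrassCurve ℚ) (_ : W'.IsElliptic) (_ : W'.IsGloballyMinimal),
      O6.ModPCongruent W' W 3 ∧ ¬ Addv W' 3 ∧ W'.HasSurjectiveModNGaloisRep 3 := by
  obtain ⟨W', i1, i2, hc, hm⟩ := exists_mult_twin_of_padicValRat_six_eight W h6 h8
  exact ⟨W', i1, i2, hc, fun h ↦ h.2 hm, hasSurjectiveModNGaloisRep_of_modPCongruent' hc hs⟩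

end Summit.BirchSwinnertonDyer.BirchSwinnertonDyer.Theorems.UniversalToricDescentHessianTwin

end
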